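import Summits.QuantumAdvantage.QuantumAdvantage.Theorems.MobiusLadderLiouvilleOrthogonalTC0StubConstSubst
import HarnessLib

/-!
# Crux `MobiusLadder.LiouvilleOrthogonalTC0` (stmt-QuantumAdvantage-1393), line `Sketch` (v7):
# guessing only the GENUINE majority gates (fan-in `≥ 3`)

Refinement of `stub_constSubst` (`…StubConstSubst.lean`). In the tree's circuit model gate functions are
extensional, and the small majority gates coincide with `AC⁰` gates: `MAJ₀ = ∧₀` (constant true),
`MAJ₁ = ∧₁` (the identity), `MAJ₂ = ∨₂` (`[2 ≤ 2·#ones] = [1 ≤ #ones]`). So a circuit "over `acBasis`"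
may well contain gates that ARE `GateFn.maj k` for `k ≤ 2`, and hypotheses about "every majority gate"
should only constrain the gates `MAJₖ` with `k ≥ 3` (which are not in `acBasis`). This file records the
three coincidences and the corresponding surgery: replacing only the majority gates of fan-in `≥ 3` by
guessed constants already yields a circuit over `acBasis`.

* `ConstSubst3.maj_zero_eq_and`, `maj_one_eq_and`, `maj_two_eq_or`, `maj_mem_acBasis_of_le_two`;
* `ConstSubst3.exists_subst3` (program surgery), `stub_constSubst3` (circuit statement).
-/

set_option linter.dupNamespace false -- D-0017: single-problem summit ⇒ `QuantumAdvantage.QuantumAdvantage` by design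

namespace Summit.QuantumAdvantage.QuantumAdvantage.Theorems.LiouvilleOrthogonalTC0

open Finset
open Literature.Computability.Complexity
open Literature.Computability.Complexity.GateList

namespace ConstSubst3

/-- `MAJ₀ = ∧₀` as gate functions (both are the constant `true` of arity `0`). -/
theorem maj_zero_eq_and : GateFn.maj 0 = GateFn.and 0 := by
  unfold GateFn.maj GateFn.and
  congr 1

/-- `MAJ₁ = ∧₁` as gate functions (both are the identity of arity `1`). -/
theorem maj_one_eq_and : GateFn.maj 1 = GateFn.and 1 := by
  unfold GateFn.maj GateFn.and
  congr 1
  funext v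
  rw [Bool.eq_iff_iff]
  simp only [decide_eq_true_eq]
  unfold GateFn.numOnes
  constructor
  · intro h i
    have hne : (univ.filter fun j : Fin 1 => v j = true).Nonempty := by
      rw [← Finset.card_pos]; omega
    obtain ⟨j, hj⟩ := hne
    rw [Finset.mem_filter] at hj
    have : i = j := Subsingleton.elim i j
    rw [this]; exact hj.2
  · intro h
    have : (univ.filter fun j : Fin 1 => v j = true) = univ :=
      Finset.filter_true_of_mem fun j _ => h j
    rw [this, Finset.card_univ, Fintype.card_fin]
    norm_num

/-- `MAJ₂ = ∨₂` as gate functions (`[2 ≤ 2·#ones] = [∃ a one]`). -/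
theorem maj_two_eq_or : GateFn.maj 2 = GateFn.or 2 := by
  unfold GateFn.maj GateFn.or
  congr 1
  funext v
  rw [Bool.eq_iff_iff]
  simp only [decide_eq_true_eq]
  unfold GateFn.numOnes
  constructor
  · intro h
    have hne : (univ.filter fun j : Fin 2 => v j = true).Nonempty := by
      rw [← Finset.card_pos]; omega
    obtain ⟨j, hj⟩ := hne
    rw [Finset.mem_filter] at hj
    exact ⟨j, hj.2⟩
  · rintro ⟨i, hi⟩
    have h1 : 1 ≤ (univ.filter fun j : Fin 2 => v j = true).card :=
      Finset.card_pos.2 ⟨i, Finset.mem_filter.2 ⟨Finset.mem_univ _, hi⟩⟩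
    omega

/-- The small majority gates are `AC⁰` gates: `MAJₖ ∈ acBasis` for `k ≤ 2`. -/
theorem maj_mem_acBasis_of_le_two {k : ℕ} (hk : k ≤ 2) : GateFn.maj k ∈ acBasis := by
  rw [mem_acBasis_iff]
  rcases Nat.lt_or_ge k 1 with h | h
  · have : k = 0 := by omega
    subst this
    exact Or.inr ⟨0, Or.inl maj_zero_eq_and⟩
  rcases Nat.lt_or_ge k 2 with h' | h'
  · have : k = 1 := by omega
    subst this
    exact Or.inr ⟨1, Or.inl maj_one_eq_and⟩
  · have : k = 2 := by omega
    subst this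
    exact Or.inr ⟨2, Or.inr maj_two_eq_or⟩

/-- A gate of `tcBasis` which is not a majority gate of fan-in `≥ 3` is a gate of `acBasis`. -/
theorem mem_acBasis_of_not_bigMaj {f : GateFn} (hf : f ∈ tcBasis) (h : ¬ ∃ k, 3 ≤ k ∧ f = GateFn.maj k) :
    f ∈ acBasis := by
  rcases hf with h' | h'
  · exact h'
  · obtain ⟨k, hk⟩ := Set.mem_iUnion.1 h'
    rw [Set.mem_singleton_iff] at hk
    by_cases hk3 : 3 ≤ k
    · exact absurd ⟨k, hk3, hk⟩ h
    · rw [hk]; exact maj_mem_acBasis_of_le_two (by omega)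

/-- **The surgery, fan-in `≥ 3` version.** As `ConstSubst.exists_subst`, but only the majority gates of
fan-in `≥ 3` are replaced by guessed constants; the program obtained is still over `acBasis`. -/
theorem exists_subst3 {n : ℕ} (v : ℕ → Bool) (gs : List (Gate (Fin n))) (hwf : WF gs)
    (hB : ∀ g ∈ gs, g.fn ∈ tcBasis) :
    ∃ gs' : List (Gate (Fin n)), WF gs' ∧ (∀ g ∈ gs', g.fn ∈ acBasis) ∧
      gs'.length = gs.length ∧
      (∀ j, (wdepths acWeight gs').getD j 0 ≤ (wdepths acWeight gs).getD j 0) ∧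
      ∀ x : Fin n → Bool,
        (∀ (j : ℕ) (hj : j < gs.length), (∃ k, 3 ≤ k ∧ (gs[j]).fn = GateFn.maj k) →
          v j = (vals gs x).getD j false) →
        vals gs' x = vals gs x := by
  induction gs using List.reverseRecOn with
  | nil => exact ⟨[], WF.nil, by simp, rfl, fun j => le_rfl, fun x _ => rfl⟩
  | append_singleton gs g ih =>
    obtain ⟨gs', hwf', hB', hlen, hdep, hval⟩ :=
      ih hwf.of_append_left fun g' hg' => hB g' (List.mem_append_left _ hg')
    have hgB : g.fn ∈ tcBasis := hB g (by simp)
    have hok : GateOK gs.length g := hwf.getLast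
    have hlen' : (wdepths acWeight gs').length = (wdepths acWeight gs).length := by simp [hlen]
    -- the hypothesis on the guesses, restricted to the prefix `gs`
    have hres : ∀ x : Fin n → Bool,
        (∀ (j : ℕ) (hj : j < (gs ++ [g]).length), (∃ k, 3 ≤ k ∧ ((gs ++ [g])[j]).fn = GateFn.maj k) →
          v j = (vals (gs ++ [g]) x).getD j false) →
        ∀ (j : ℕ) (hj : j < gs.length), (∃ k, 3 ≤ k ∧ (gs[j]).fn = GateFn.maj k) →
          v j = (vals gs x).getD j false := by
      intro x H j hj hmaj
      have hj' : j < (gs ++ [g]).length := by simp; omega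
      have h1 := H j hj' (by rw [List.getElem_append_left hj]; exact hmaj)
      rw [h1, vals_append_singleton, List.getD_append _ _ _ _ (by simpa using hj)]
    by_cases hmaj : ∃ k, 3 ≤ k ∧ g.fn = GateFn.maj k
    · -- a genuine majority gate: replaced by the guessed constant `v |gs|`
      refine ⟨gs' ++ [GateList.constGate (Fin n) (v gs.length)],
        hwf'.append_singleton (gateOK_constGate _ _), ?_, by simp [hlen], ?_, ?_⟩
      · intro g' hg'
        rw [List.mem_append, List.mem_singleton] at hg'
        rcases hg' with hg' | rfl
        · exact hB' g' hg'
        · rw [GateList.constGate_fn]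
          exact const_mem_acBasis _
      · rw [wdepths_append_singleton, wdepths_append_singleton]
        refine ConstSubst.getD_append_singleton_le hlen' hdep ?_
        obtain ⟨k, -, hk⟩ := hmaj
        rw [GateList.constGate_fn, acWeight_const, hk, acWeight_maj]
        exact Nat.add_le_add_left ((Finset.sup_le fun a _ => a.elim0).trans (Nat.zero_le _)) 1
      · intro x H
        have hL : gs.length < (gs ++ [g]).length := by simp
        have h1 := H gs.length hL (by rw [List.getElem_concat_length rfl]; exact hmaj)
        rw [getD_vals_append_singleton] at h1
        rw [vals_append_singleton, vals_append_singleton, hval x (hres x H), ← h1]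
        rfl
    · -- any other gate is a gate of `acBasis`: kept, at the same position
      have hgA : g.fn ∈ acBasis := mem_acBasis_of_not_bigMaj hgB hmaj
      refine ⟨gs' ++ [g], hwf'.append_singleton (hok.mono hlen.ge), ?_, by simp [hlen], ?_, ?_⟩
      · intro g' hg'
        rw [List.mem_append, List.mem_singleton] at hg'
        rcases hg' with hg' | rfl
        · exact hB' g' hg'
        · exact hgA
      · rw [wdepths_append_singleton, wdepths_append_singleton]
        refine ConstSubst.getD_append_singleton_le hlen' hdep ?_
        refine Nat.add_le_add_left (Finset.sup_mono_fun fun a _ => ?_) _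
        cases g.args a with
        | inl i => rw [wireDepthOf_inl, wireDepthOf_inl]
        | inr m => rw [wireDepthOf_inr, wireDepthOf_inr]; exact hdep m
      · intro x H
        rw [vals_append_singleton, vals_append_singleton, hval x (hres x H)]

end ConstSubst3

/-- **Constants for the genuine majority gates** (fan-in `≥ 3`): replacing every gate `MAJₖ`, `k ≥ 3`,
of a `tcBasis` circuit `C` by the constant prescribed by the guess `v` gives a circuit over `acBasis`
(the small majority gates `MAJ₀ = ∧₀`, `MAJ₁ = ∧₁`, `MAJ₂ = ∨₂` ARE `AC⁰` gates) with no larger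
`acDepth` and size, agreeing with `C` wherever the guess is right. -/
theorem stub_constSubst3 {n : ℕ} (C : Circuit (Fin n)) (hB : C.IsOver tcBasis) (v : ℕ → Bool) :
    ∃ C' : Circuit (Fin n), C'.IsOver acBasis ∧ C'.acDepth ≤ C.acDepth ∧ C'.size ≤ C.size ∧
      ∀ x : Fin n → Bool,
        (∀ (j : ℕ) (hj : j < C.gates.length), (∃ k, 3 ≤ k ∧ (C.gates[j]).fn = GateFn.maj k) →
          v j = (GateList.vals C.gates x).getD j false) →
        C'.eval x = C.eval x := by
  obtain ⟨gs', hwf', hB', hlen, hdep, hval⟩ := ConstSubst3.exists_subst3 v C.gates (wf_gates C) hB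
  have ho : OutOK gs'.length C.output := fun m hm => by
    rw [hlen]
    exact C.wf_output m hm
  have hd : wireDepthOf (wdepths acWeight gs') C.output ≤ C.acDepth := by
    have h0 : C.acDepth = wireDepthOf (wdepths acWeight C.gates) C.output :=
      circuit_depthWith C acWeight
    rw [h0]
    cases C.output with
    | inl i => rw [wireDepthOf_inl, wireDepthOf_inl]
    | inr m => rw [wireDepthOf_inr, wireDepthOf_inr]; exact hdep m
  have hreal : ACRealOver acBasis (fun x => wireOf x (vals gs' x) C.output) C.acDepth C.size :=
    ⟨gs', C.output, hwf', hB', ho, hlen.le, hd, fun x => rfl⟩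
  obtain ⟨C', hO', hd', hs', hev'⟩ := hreal.toCircuit
  refine ⟨C', hO', hd', hs', fun x hx => ?_⟩
  rw [hev' x]
  show wireOf x (vals gs' x) C.output = C.eval x
  rw [circuit_eval, hval x hx]

end Summit.QuantumAdvantage.QuantumAdvantage.Theorems.LiouvilleOrthogonalTC0
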